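import Mathlib
import Summits.NavierStokesRegularity.NavierStokesRegularity.Theses.TypeIIInviscidRelaxation
import Summits.NavierStokesRegularity.NavierStokesRegularity.Theorems.TypeIIInviscidRelaxationMonopoleCoreExclusionStubAxisymComparisonFlowOfAX
import Literature.Analysis.FluidPDE.TypeIICoreWitness
import HarnessLib

/-!
# Crux `MonopoleCoreExclusion` (stmt-NavierStokesRegularity-1965), line `axisymmetric_comparison_flow`: the shadowing
# obligation the composition ACTUALLY consumes — one level `K`, explicit closeness budget `A = 2`

`--supports stmt-NavierStokesRegularity-1965` (helper file; theorems only, no definitions, no `sorry`).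

The registered skeleton (`dd3458b3c2b350bd`) composes the crux (which carries `AxisymSwirlRegular` as antecedent) from
three stubs; the transfer stub `stub_axisymComparisonFlowOfAX` is landed (p830344/p830482) with an EXISTENTIAL universal
constant `∃ A > 0`, although its proof produces `A = 2` (the azimuthal-average datum is `2V/K`-close).  Because the
constant is hidden, the composition calls the [XL] shadowing stub `stub_axisymShadowing` at every `A > 0`.  This file
makes the constant visible and records the exact residue, mirroring the columnar companion
`…ColumnarCoreExclusionExplicitBudget` (p840687):

* `AxisymComparisonFlow.axisymComparisonFlowOfAX_two` — the transfer stub with the EXPLICIT budget `2·V/K` (same proof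
  as p830482: azimuthal-average datum + axisymmetric divergence-free cut-off + symmetric slab-bounded continuation from
  `AxisymSwirlRegular` + covariance).
* `CoreExclusionShadowing.levelTwoShadowing_of_axisymShadowing` — the registered shadowing stub implies its level-`2`
  single-level instance `∃ K ≥ 1, P₂(K)` (instantiate `A = 2`, `K = K₀`; cf. `axisymShadowing_iff_singleLevel`,
  p840666).
* `CoreExclusionShadowing.monopoleCoreExclusion_of_anchor_of_levelTwoShadowing` — KERNEL COMPOSITION: the anchor stub
  `stub_anchoredLateAxisymWitness` (statement verbatim, as a hypothesis) and the SINGLE explicit statement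
  `∃ K ≥ 1, P₂(K)` give the crux `MonopoleCoreExclusion` BY NAME.  Here `P₂(K)` reads: «a classical Leray–Hopf
  solution on `[0,T)` (rapidly decaying datum) with `‖u(t)‖ ≤ V`, a near-maximum within `L` of `x₀`, `Kν ≤ LV`,
  `(T - t)V ≤ KL`, and a bounded classical flow on `[t,T]`, exactly axisymmetric about `x₀ + ℝ·Q e_z`, that is
  `2V/K`-close to `u(t)` on `B(x₀, KL)`, is bounded on `[t,T) × B(x₀, KL/2)`».
* `CoreExclusionShadowing.monopoleCoreExclusion_of_anchor_of_axisymShadowing` — sanity: the registered pair factors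
  through the explicit pair.
* `CoreExclusionShadowing.monopoleCoreExclusion_of_levelPair` — the SINGLE-LEVEL merged residue: one `K ≥ 1` with
  `P₂(K)` and the anchor statement at that level already gives the crux.

Honest framing.  Bookkeeping that SHRINKS the typed research residue of the line from a two-quantifier family over all
budgets `A` to one existential level at budget `2`; the residue (finite-horizon local non-blow-up of late
`2V/K`-near-axisymmetric cores at core Reynolds number `≥ K`) is untouched and remains the open content.  No stub is
closed by name; nothing about Navier–Stokes regularity is claimed; rung 0.
-/

noncomputable section

open Set Metric MeasureTheory Function
open Literature.Analysis Literature.Analysis.FluidPDE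
open scoped InnerProductSpace ContDiff

namespace Summit.NavierStokesRegularity.NavierStokesRegularity.Theorems

-- the problem directory repeats the summit name (`NavierStokesRegularity/NavierStokesRegularity`)
set_option linter.dupNamespace false

namespace AxisymComparisonFlow

open ColumnarComparisonDatum (isDivFree_comp_add)
open AzimuthalComparisonDatum (exists_smooth_axisym_azimuthalAverage_close_ball)

/-- **Axisymmetric comparison flow with the explicit budget `A = 2`** (given `AxisymSwirlRegular`).  From a
level-`K ≥ 1` axisymmetric core datum at time `t` of a classical solution `u` on `[0,T)` one builds a bounded classical
Navier–Stokes solution `v` on `[t, T]`, exactly axisymmetric about the witness axis, with `‖u(t,x) - v(t,x)‖ ≤ 2V/K`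
on `ball x₀ (KL)` — the proof of the registered stub `stub_axisymComparisonFlowOfAX` (p830482) with its constant
exposed: azimuthal-average datum (`2V/K`-close), cut-off, slab-bounded symmetric continuation
(`exists_axisym_flow_of_frame_datum_slab`, `AxisymKatoGlobal.slabAxisym_of_axisymmetricSwirlRegularity`),
shift / rotation / translation covariance.  The Leray–Hopf, decay, `0 < T`, `0 < t` and Reynolds hypotheses are not
used. [cite: Tao2011, Lemma 8.1] -/
theorem axisymComparisonFlowOfAX_two
    (hAX : Summit.NavierStokesRegularity.NavierStokesRegularity.Theses.TypeIIInviscidRelaxation.AxisymSwirlRegular) :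
    ∀ (ν T t K : ℝ) (u : ℝ → EuclideanSpace ℝ (Fin 3) → EuclideanSpace ℝ (Fin 3))
      (p : ℝ → EuclideanSpace ℝ (Fin 3) → ℝ),
      0 < ν → 0 < T → IsClassicalNSSolutionOn (Ico 0 T) ν 0 u p → IsLerayHopfOn T ν 0 (u 0) u →
      HasRapidSpatialDecay (u 0) → 0 < t → t < T → 1 ≤ K →
      ∀ (x₀ : EuclideanSpace ℝ (Fin 3)) (L V : ℝ)
        (Q : EuclideanSpace ℝ (Fin 3) ≃ₗᵢ[ℝ] EuclideanSpace ℝ (Fin 3))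
        (W : EuclideanSpace ℝ (Fin 3) → EuclideanSpace ℝ (Fin 3)),
        0 < L → 0 < V → IsAxisymmetric W → (∀ x, ‖u t x‖ ≤ V) → K * ν ≤ L * V →
        (∀ y : EuclideanSpace ℝ (Fin 3), ‖y‖ ≤ K →
          ‖V⁻¹ • Q.symm (u t (x₀ + L • Q y)) - W y‖ ≤ K⁻¹) →
        ∃ (v : ℝ → EuclideanSpace ℝ (Fin 3) → EuclideanSpace ℝ (Fin 3))
          (q : ℝ → EuclideanSpace ℝ (Fin 3) → ℝ) (Mv : ℝ),
          IsClassicalNSSolutionOn (Icc t T) ν 0 v q ∧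
          (∀ s ∈ Icc t T, IsAxisymmetric (fun y : EuclideanSpace ℝ (Fin 3) => Q.symm (v s (x₀ + Q y)))) ∧
          (∀ s ∈ Icc t T, ∀ x, ‖v s x‖ ≤ Mv) ∧
          (∀ x ∈ ball x₀ (K * L), ‖u t x - v t x‖ ≤ 2 * V / K) := by
  intro ν T t K u p hν _hT hns _hLH _hdec ht htT hK x₀ L V Q W hL hV hW hbd _hRe hclose
  have hK0 : 0 < K := lt_of_lt_of_le one_pos hK
  have hKL : 0 < K * L := mul_pos hK0 hL
  have ht_mem : t ∈ Ico 0 T := ⟨ht.le, htT⟩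
  -- (1) the azimuthal-average datum in physical coordinates (adapted from p830482)
  obtain ⟨v₀, hv₀s, hv₀div, hv₀ax, -, hv₀close⟩ :=
    exists_smooth_axisym_azimuthalAverage_close_ball u t (hns.contDiff_velocity ht_mem) (hns.divFree t ht_mem)
      x₀ L V K Q W hL hV hW hbd hclose
  -- (2) its frame form
  set g : EuclideanSpace ℝ (Fin 3) → EuclideanSpace ℝ (Fin 3) := fun Y => Q.symm (v₀ (x₀ + Q Y)) with hg_def
  have hg : ContDiff ℝ ∞ g := Q.symm.contDiff.comp (hv₀s.comp (contDiff_const.add Q.contDiff))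
  have hgdiv : VectorCalculus.IsDivFree g := by
    have h1 : VectorCalculus.IsDivFree fun y => v₀ (y + x₀) := isDivFree_comp_add hv₀div x₀
    have h2 := h1.conj_linearIsometryEquiv (R := Q.symm)
    refine fun y => ?_
    have := h2 y
    simpa [hg_def, add_comm] using this
  have hgax : IsAxisymmetric g := hv₀ax
  -- (3)–(4) cut off, launch by the symmetric slab-bounded continuation, shift, rotate, translate
  obtain ⟨v, q, Mv, hv, hvax, hvbd, hvt⟩ :=
    exists_axisym_flow_of_frame_datum_slab
      (AxisymKatoGlobal.slabAxisym_of_axisymmetricSwirlRegularity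
        (fun ν hν u₀ hsm hdiv hdec hax => hAX ν hν u₀ hsm hdiv hdec hax)) hg hgdiv hgax hKL hν htT x₀ Q
  refine ⟨v, q, Mv, hv, hvax, hvbd, fun x hx => ?_⟩
  have hY : ‖Q.symm (x - x₀)‖ < K * L := by
    rw [LinearIsometryEquiv.norm_map, ← dist_eq_norm]; exact mem_ball.1 hx
  rw [hvt x hY]
  have e : Q (g (Q.symm (x - x₀))) = v₀ x := by
    show Q (Q.symm (v₀ (x₀ + Q (Q.symm (x - x₀))))) = v₀ x
    rw [LinearIsometryEquiv.apply_symm_apply, LinearIsometryEquiv.apply_symm_apply, add_sub_cancel]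
  rw [e]
  exact hv₀close x hx

end AxisymComparisonFlow

namespace CoreExclusionShadowing

/-- **The registered axisymmetric shadowing stub implies its explicit level-`2` instance.**  From
`stub_axisymShadowing` (statement verbatim, hypothesis) one gets `∃ K ≥ 1, P₂(K)` — instantiate the budget `A = 2` and
the level `K = K₀` (the single-level form of `CoreExclusionShadowing.axisymShadowing_iff_singleLevel`, p840666).
[folklore] -/
theorem levelTwoShadowing_of_axisymShadowing
    (h : ∀ A : ℝ, 0 < A → ∃ K₀ : ℝ, 1 ≤ K₀ ∧ ∀ K : ℝ, K₀ ≤ K →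
      ∀ (ν T t : ℝ) (u : ℝ → EuclideanSpace ℝ (Fin 3) → EuclideanSpace ℝ (Fin 3))
        (p : ℝ → EuclideanSpace ℝ (Fin 3) → ℝ),
        0 < ν → 0 < T → IsClassicalNSSolutionOn (Ico 0 T) ν 0 u p → IsLerayHopfOn T ν 0 (u 0) u →
        HasRapidSpatialDecay (u 0) → 0 < t → t < T →
        ∀ (x₀ : EuclideanSpace ℝ (Fin 3)) (L V : ℝ)
          (Q : EuclideanSpace ℝ (Fin 3) ≃ₗᵢ[ℝ] EuclideanSpace ℝ (Fin 3)),
          0 < L → 0 < V → (∀ x, ‖u t x‖ ≤ V) →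
          (∃ x₁, dist x₁ x₀ ≤ L ∧ V ≤ 2 * ‖u t x₁‖) → K * ν ≤ L * V → (T - t) * V ≤ K * L →
          ∀ (v : ℝ → EuclideanSpace ℝ (Fin 3) → EuclideanSpace ℝ (Fin 3))
            (q : ℝ → EuclideanSpace ℝ (Fin 3) → ℝ) (Mv : ℝ),
            IsClassicalNSSolutionOn (Icc t T) ν 0 v q →
            (∀ s ∈ Icc t T, IsAxisymmetric (fun y : EuclideanSpace ℝ (Fin 3) => Q.symm (v s (x₀ + Q y)))) →
            (∀ s ∈ Icc t T, ∀ x, ‖v s x‖ ≤ Mv) →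
            (∀ x ∈ ball x₀ (K * L), ‖u t x - v t x‖ ≤ A * V / K) →
            ∃ M : ℝ, ∀ s ∈ Ico t T, ∀ x ∈ ball x₀ (K * L / 2), ‖u s x‖ ≤ M) :
    ∃ K : ℝ, 1 ≤ K ∧
      ∀ (ν T t : ℝ) (u : ℝ → EuclideanSpace ℝ (Fin 3) → EuclideanSpace ℝ (Fin 3))
        (p : ℝ → EuclideanSpace ℝ (Fin 3) → ℝ),
        0 < ν → 0 < T → IsClassicalNSSolutionOn (Ico 0 T) ν 0 u p → IsLerayHopfOn T ν 0 (u 0) u →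
        HasRapidSpatialDecay (u 0) → 0 < t → t < T →
        ∀ (x₀ : EuclideanSpace ℝ (Fin 3)) (L V : ℝ)
          (Q : EuclideanSpace ℝ (Fin 3) ≃ₗᵢ[ℝ] EuclideanSpace ℝ (Fin 3)),
          0 < L → 0 < V → (∀ x, ‖u t x‖ ≤ V) →
          (∃ x₁, dist x₁ x₀ ≤ L ∧ V ≤ 2 * ‖u t x₁‖) → K * ν ≤ L * V → (T - t) * V ≤ K * L →
          ∀ (v : ℝ → EuclideanSpace ℝ (Fin 3) → EuclideanSpace ℝ (Fin 3))
            (q : ℝ → EuclideanSpace ℝ (Fin 3) → ℝ) (Mv : ℝ),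
            IsClassicalNSSolutionOn (Icc t T) ν 0 v q →
            (∀ s ∈ Icc t T, IsAxisymmetric (fun y : EuclideanSpace ℝ (Fin 3) => Q.symm (v s (x₀ + Q y)))) →
            (∀ s ∈ Icc t T, ∀ x, ‖v s x‖ ≤ Mv) →
            (∀ x ∈ ball x₀ (K * L), ‖u t x - v t x‖ ≤ 2 * V / K) →
            ∃ M : ℝ, ∀ s ∈ Ico t T, ∀ x ∈ ball x₀ (K * L / 2), ‖u s x‖ ≤ M := by
  obtain ⟨K₀, hK₀, hK⟩ := h 2 (by norm_num)
  exact ⟨K₀, hK₀, hK K₀ le_rfl⟩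

/-- **Kernel composition with the explicit residue.**  The anchor stub `stub_anchoredLateAxisymWitness` (statement
verbatim, hypothesis `hanchor`) and the SINGLE explicit shadowing statement `∃ K ≥ 1, P₂(K)` (hypothesis `hshadow`)
imply the crux `MonopoleCoreExclusion` BY NAME: `AxisymSwirlRegular` (the crux's antecedent) feeds
`axisymComparisonFlowOfAX_two`; take the level `K`, a late level-`K` axisymmetric witness anchored at the singular
point `xs`, the comparison flow (`2V/K`-close on `B(x₀, KL)`), the bound on `[t,T) × B(x₀, KL/2) ⊇ (T - ρ², T) × B_ρ(xs)`
with `ρ = min (KL/4) √(T - t)` — contradicting the singularity of `xs` (same arithmetic as the registered composition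
`MonopoleCoreExclusion_of`). [folklore] -/
theorem monopoleCoreExclusion_of_anchor_of_levelTwoShadowing
    (hanchor : ∀ (ν T : ℝ) (u : ℝ → EuclideanSpace ℝ (Fin 3) → EuclideanSpace ℝ (Fin 3))
      (p : ℝ → EuclideanSpace ℝ (Fin 3) → ℝ),
      0 < ν → 0 < T → IsMaximalSmoothSolution ν 0 u p T → IsLerayHopfOn T ν 0 (u 0) u →
      HasRapidSpatialDecay (u 0) → ¬ IsTypeIBlowup u T →
      (∀ K : ℝ, 0 < K → ∀ t₀ < T, ∃ t, t₀ < t ∧ t < T ∧ TypeIICoreWitness IsAxisymmetric ν K u t) →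
      ∃ xs : EuclideanSpace ℝ (Fin 3),
        (¬ ∃ ρ M : ℝ, 0 < ρ ∧ ∀ s ∈ Ioo (T - ρ ^ 2) T, ∀ x ∈ ball xs ρ, ‖u s x‖ ≤ M) ∧
        ∀ K : ℝ, 0 < K → ∃ t : ℝ, 0 < t ∧ t < T ∧
          ∃ (x₀ : EuclideanSpace ℝ (Fin 3)) (L V : ℝ)
            (Q : EuclideanSpace ℝ (Fin 3) ≃ₗᵢ[ℝ] EuclideanSpace ℝ (Fin 3))
            (W : EuclideanSpace ℝ (Fin 3) → EuclideanSpace ℝ (Fin 3)),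
            0 < L ∧ 0 < V ∧ IsAxisymmetric W ∧ (∀ x, ‖u t x‖ ≤ V) ∧
            (∃ x₁, dist x₁ x₀ ≤ L ∧ V ≤ 2 * ‖u t x₁‖) ∧
            (∃ y y' : EuclideanSpace ℝ (Fin 3), ‖y‖ ≤ 1 ∧ ‖y'‖ ≤ 1 ∧ (4 : ℝ)⁻¹ ≤ ‖W y - W y'‖) ∧
            K * ν ≤ L * V ∧
            (∀ y : EuclideanSpace ℝ (Fin 3), ‖y‖ ≤ K →
              ‖V⁻¹ • Q.symm (u t (x₀ + L • Q y)) - W y‖ ≤ K⁻¹) ∧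
            (T - t) * V ≤ K * L ∧ dist xs x₀ ≤ K * L / 4)
    (hshadow : ∃ K : ℝ, 1 ≤ K ∧
      ∀ (ν T t : ℝ) (u : ℝ → EuclideanSpace ℝ (Fin 3) → EuclideanSpace ℝ (Fin 3))
        (p : ℝ → EuclideanSpace ℝ (Fin 3) → ℝ),
        0 < ν → 0 < T → IsClassicalNSSolutionOn (Ico 0 T) ν 0 u p → IsLerayHopfOn T ν 0 (u 0) u →
        HasRapidSpatialDecay (u 0) → 0 < t → t < T →
        ∀ (x₀ : EuclideanSpace ℝ (Fin 3)) (L V : ℝ)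
          (Q : EuclideanSpace ℝ (Fin 3) ≃ₗᵢ[ℝ] EuclideanSpace ℝ (Fin 3)),
          0 < L → 0 < V → (∀ x, ‖u t x‖ ≤ V) →
          (∃ x₁, dist x₁ x₀ ≤ L ∧ V ≤ 2 * ‖u t x₁‖) → K * ν ≤ L * V → (T - t) * V ≤ K * L →
          ∀ (v : ℝ → EuclideanSpace ℝ (Fin 3) → EuclideanSpace ℝ (Fin 3))
            (q : ℝ → EuclideanSpace ℝ (Fin 3) → ℝ) (Mv : ℝ),
            IsClassicalNSSolutionOn (Icc t T) ν 0 v q →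
            (∀ s ∈ Icc t T, IsAxisymmetric (fun y : EuclideanSpace ℝ (Fin 3) => Q.symm (v s (x₀ + Q y)))) →
            (∀ s ∈ Icc t T, ∀ x, ‖v s x‖ ≤ Mv) →
            (∀ x ∈ ball x₀ (K * L), ‖u t x - v t x‖ ≤ 2 * V / K) →
            ∃ M : ℝ, ∀ s ∈ Ico t T, ∀ x ∈ ball x₀ (K * L / 2), ‖u s x‖ ≤ M) :
    Summit.NavierStokesRegularity.NavierStokesRegularity.Theses.TypeIIInviscidRelaxation.MonopoleCoreExclusion := by
  intro hAX ν T hν hT u p hmax hLH hdec hnI hw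
  obtain ⟨K₀, hK₀1, hstab⟩ := hshadow
  have hK₀ : 0 < K₀ := lt_of_lt_of_le one_pos hK₀1
  obtain ⟨xs, hsing, hcov⟩ := hanchor ν T u p hν hT hmax hLH hdec hnI hw
  obtain ⟨t, ht0, htT, x₀, L, V, Q, W, hL, hV, hax, hbd, hnear, _hosc, hRe, hclose, hlate, hdist⟩ :=
    hcov K₀ hK₀
  obtain ⟨v, q, Mv, hv, hvax, hvbd, hvclose⟩ :=
    AxisymComparisonFlow.axisymComparisonFlowOfAX_two hAX ν T t K₀ u p hν hT hmax.1 hLH hdec ht0 htT hK₀1 x₀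
      L V Q W hL hV hax hbd hRe hclose
  obtain ⟨M, hM⟩ := hstab ν T t u p hν hT hmax.1 hLH hdec ht0 htT x₀ L V Q hL hV hbd hnear hRe hlate v q
    Mv hv hvax hvbd hvclose
  apply hsing
  have hTt : 0 < T - t := sub_pos.2 htT
  set ρ : ℝ := min (K₀ * L / 4) (Real.sqrt (T - t)) with hρ
  have hρpos : 0 < ρ := lt_min (by positivity) (Real.sqrt_pos.2 hTt)
  have hρsq : ρ ^ 2 ≤ T - t :=
    calc ρ ^ 2 ≤ (Real.sqrt (T - t)) ^ 2 := pow_le_pow_left₀ hρpos.le (min_le_right _ _) 2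
      _ = T - t := Real.sq_sqrt hTt.le
  have hρle : ρ ≤ K₀ * L / 4 := min_le_left _ _
  refine ⟨ρ, M, hρpos, fun s hs x hx => hM s ⟨?_, hs.2⟩ x ?_⟩
  · linarith [hs.1]
  · rw [mem_ball] at hx ⊢
    calc dist x x₀ ≤ dist x xs + dist xs x₀ := dist_triangle _ _ _
      _ < ρ + K₀ * L / 4 := by linarith
      _ ≤ K₀ * L / 4 + K₀ * L / 4 := by linarith
      _ = K₀ * L / 2 := by ring

/-- **Sanity: the registered pair factors through the explicit pair.**  The anchor stub together with the REGISTERED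
shadowing stub `stub_axisymShadowing` (both verbatim, as hypotheses) gives the crux through
`levelTwoShadowing_of_axisymShadowing` and `monopoleCoreExclusion_of_anchor_of_levelTwoShadowing` — the explicit
composition loses nothing relative to `MonopoleCoreExclusion_of`. [folklore] -/
theorem monopoleCoreExclusion_of_anchor_of_axisymShadowing
    (hanchor : ∀ (ν T : ℝ) (u : ℝ → EuclideanSpace ℝ (Fin 3) → EuclideanSpace ℝ (Fin 3))
      (p : ℝ → EuclideanSpace ℝ (Fin 3) → ℝ),
      0 < ν → 0 < T → IsMaximalSmoothSolution ν 0 u p T → IsLerayHopfOn T ν 0 (u 0) u →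
      HasRapidSpatialDecay (u 0) → ¬ IsTypeIBlowup u T →
      (∀ K : ℝ, 0 < K → ∀ t₀ < T, ∃ t, t₀ < t ∧ t < T ∧ TypeIICoreWitness IsAxisymmetric ν K u t) →
      ∃ xs : EuclideanSpace ℝ (Fin 3),
        (¬ ∃ ρ M : ℝ, 0 < ρ ∧ ∀ s ∈ Ioo (T - ρ ^ 2) T, ∀ x ∈ ball xs ρ, ‖u s x‖ ≤ M) ∧
        ∀ K : ℝ, 0 < K → ∃ t : ℝ, 0 < t ∧ t < T ∧
          ∃ (x₀ : EuclideanSpace ℝ (Fin 3)) (L V : ℝ)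
            (Q : EuclideanSpace ℝ (Fin 3) ≃ₗᵢ[ℝ] EuclideanSpace ℝ (Fin 3))
            (W : EuclideanSpace ℝ (Fin 3) → EuclideanSpace ℝ (Fin 3)),
            0 < L ∧ 0 < V ∧ IsAxisymmetric W ∧ (∀ x, ‖u t x‖ ≤ V) ∧
            (∃ x₁, dist x₁ x₀ ≤ L ∧ V ≤ 2 * ‖u t x₁‖) ∧
            (∃ y y' : EuclideanSpace ℝ (Fin 3), ‖y‖ ≤ 1 ∧ ‖y'‖ ≤ 1 ∧ (4 : ℝ)⁻¹ ≤ ‖W y - W y'‖) ∧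
            K * ν ≤ L * V ∧
            (∀ y : EuclideanSpace ℝ (Fin 3), ‖y‖ ≤ K →
              ‖V⁻¹ • Q.symm (u t (x₀ + L • Q y)) - W y‖ ≤ K⁻¹) ∧
            (T - t) * V ≤ K * L ∧ dist xs x₀ ≤ K * L / 4)
    (hshadow : ∀ A : ℝ, 0 < A → ∃ K₀ : ℝ, 1 ≤ K₀ ∧ ∀ K : ℝ, K₀ ≤ K →
      ∀ (ν T t : ℝ) (u : ℝ → EuclideanSpace ℝ (Fin 3) → EuclideanSpace ℝ (Fin 3))
        (p : ℝ → EuclideanSpace ℝ (Fin 3) → ℝ),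
        0 < ν → 0 < T → IsClassicalNSSolutionOn (Ico 0 T) ν 0 u p → IsLerayHopfOn T ν 0 (u 0) u →
        HasRapidSpatialDecay (u 0) → 0 < t → t < T →
        ∀ (x₀ : EuclideanSpace ℝ (Fin 3)) (L V : ℝ)
          (Q : EuclideanSpace ℝ (Fin 3) ≃ₗᵢ[ℝ] EuclideanSpace ℝ (Fin 3)),
          0 < L → 0 < V → (∀ x, ‖u t x‖ ≤ V) →
          (∃ x₁, dist x₁ x₀ ≤ L ∧ V ≤ 2 * ‖u t x₁‖) → K * ν ≤ L * V → (T - t) * V ≤ K * L →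
          ∀ (v : ℝ → EuclideanSpace ℝ (Fin 3) → EuclideanSpace ℝ (Fin 3))
            (q : ℝ → EuclideanSpace ℝ (Fin 3) → ℝ) (Mv : ℝ),
            IsClassicalNSSolutionOn (Icc t T) ν 0 v q →
            (∀ s ∈ Icc t T, IsAxisymmetric (fun y : EuclideanSpace ℝ (Fin 3) => Q.symm (v s (x₀ + Q y)))) →
            (∀ s ∈ Icc t T, ∀ x, ‖v s x‖ ≤ Mv) →
            (∀ x ∈ ball x₀ (K * L), ‖u t x - v t x‖ ≤ A * V / K) →
            ∃ M : ℝ, ∀ s ∈ Ico t T, ∀ x ∈ ball x₀ (K * L / 2), ‖u s x‖ ≤ M) :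
    Summit.NavierStokesRegularity.NavierStokesRegularity.Theses.TypeIIInviscidRelaxation.MonopoleCoreExclusion :=
  monopoleCoreExclusion_of_anchor_of_levelTwoShadowing hanchor (levelTwoShadowing_of_axisymShadowing hshadow)

/-- **Single-level merged residue of the line.**  ONE level `K ≥ 1` carrying BOTH the explicit axisymmetric shadowing
statement `P₂(K)` and the anchor statement AT THAT LEVEL («every solution of the crux class has a point `xs` singular at
`T` and a late, `xs`-anchored level-`K` axisymmetric witness») already gives the crux `MonopoleCoreExclusion` BY NAME —
the weakest conjunction of the two research obligations that the comparison-flow composition can consume.  Same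
arithmetic as `monopoleCoreExclusion_of_anchor_of_levelTwoShadowing`. [folklore] -/
theorem monopoleCoreExclusion_of_levelPair
    (h : ∃ K : ℝ, 1 ≤ K ∧
      (∀ (ν T t : ℝ) (u : ℝ → EuclideanSpace ℝ (Fin 3) → EuclideanSpace ℝ (Fin 3))
        (p : ℝ → EuclideanSpace ℝ (Fin 3) → ℝ),
        0 < ν → 0 < T → IsClassicalNSSolutionOn (Ico 0 T) ν 0 u p → IsLerayHopfOn T ν 0 (u 0) u →
        HasRapidSpatialDecay (u 0) → 0 < t → t < T →
        ∀ (x₀ : EuclideanSpace ℝ (Fin 3)) (L V : ℝ)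
          (Q : EuclideanSpace ℝ (Fin 3) ≃ₗᵢ[ℝ] EuclideanSpace ℝ (Fin 3)),
          0 < L → 0 < V → (∀ x, ‖u t x‖ ≤ V) →
          (∃ x₁, dist x₁ x₀ ≤ L ∧ V ≤ 2 * ‖u t x₁‖) → K * ν ≤ L * V → (T - t) * V ≤ K * L →
          ∀ (v : ℝ → EuclideanSpace ℝ (Fin 3) → EuclideanSpace ℝ (Fin 3))
            (q : ℝ → EuclideanSpace ℝ (Fin 3) → ℝ) (Mv : ℝ),
            IsClassicalNSSolutionOn (Icc t T) ν 0 v q →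
            (∀ s ∈ Icc t T, IsAxisymmetric (fun y : EuclideanSpace ℝ (Fin 3) => Q.symm (v s (x₀ + Q y)))) →
            (∀ s ∈ Icc t T, ∀ x, ‖v s x‖ ≤ Mv) →
            (∀ x ∈ ball x₀ (K * L), ‖u t x - v t x‖ ≤ 2 * V / K) →
            ∃ M : ℝ, ∀ s ∈ Ico t T, ∀ x ∈ ball x₀ (K * L / 2), ‖u s x‖ ≤ M) ∧
      (∀ (ν T : ℝ) (u : ℝ → EuclideanSpace ℝ (Fin 3) → EuclideanSpace ℝ (Fin 3))
        (p : ℝ → EuclideanSpace ℝ (Fin 3) → ℝ),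
        0 < ν → 0 < T → IsMaximalSmoothSolution ν 0 u p T → IsLerayHopfOn T ν 0 (u 0) u →
        HasRapidSpatialDecay (u 0) → ¬ IsTypeIBlowup u T →
        (∀ K' : ℝ, 0 < K' → ∀ t₀ < T, ∃ t, t₀ < t ∧ t < T ∧ TypeIICoreWitness IsAxisymmetric ν K' u t) →
        ∃ xs : EuclideanSpace ℝ (Fin 3),
          (¬ ∃ ρ M : ℝ, 0 < ρ ∧ ∀ s ∈ Ioo (T - ρ ^ 2) T, ∀ x ∈ ball xs ρ, ‖u s x‖ ≤ M) ∧
          ∃ t : ℝ, 0 < t ∧ t < T ∧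
            ∃ (x₀ : EuclideanSpace ℝ (Fin 3)) (L V : ℝ)
              (Q : EuclideanSpace ℝ (Fin 3) ≃ₗᵢ[ℝ] EuclideanSpace ℝ (Fin 3))
              (W : EuclideanSpace ℝ (Fin 3) → EuclideanSpace ℝ (Fin 3)),
              0 < L ∧ 0 < V ∧ IsAxisymmetric W ∧ (∀ x, ‖u t x‖ ≤ V) ∧
              (∃ x₁, dist x₁ x₀ ≤ L ∧ V ≤ 2 * ‖u t x₁‖) ∧
              (∃ y y' : EuclideanSpace ℝ (Fin 3), ‖y‖ ≤ 1 ∧ ‖y'‖ ≤ 1 ∧ (4 : ℝ)⁻¹ ≤ ‖W y - W y'‖) ∧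
              K * ν ≤ L * V ∧
              (∀ y : EuclideanSpace ℝ (Fin 3), ‖y‖ ≤ K →
                ‖V⁻¹ • Q.symm (u t (x₀ + L • Q y)) - W y‖ ≤ K⁻¹) ∧
              (T - t) * V ≤ K * L ∧ dist xs x₀ ≤ K * L / 4)) :
    Summit.NavierStokesRegularity.NavierStokesRegularity.Theses.TypeIIInviscidRelaxation.MonopoleCoreExclusion := by
  intro hAX ν T hν hT u p hmax hLH hdec hnI hw
  obtain ⟨K₀, hK₀1, hstab, hanchor⟩ := h
  obtain ⟨xs, hsing, t, ht0, htT, x₀, L, V, Q, W, hL, hV, hax, hbd, hnear, _hosc, hRe, hclose, hlate, hdist⟩ :=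
    hanchor ν T u p hν hT hmax hLH hdec hnI hw
  obtain ⟨v, q, Mv, hv, hvax, hvbd, hvclose⟩ :=
    AxisymComparisonFlow.axisymComparisonFlowOfAX_two hAX ν T t K₀ u p hν hT hmax.1 hLH hdec ht0 htT hK₀1 x₀
      L V Q W hL hV hax hbd hRe hclose
  obtain ⟨M, hM⟩ := hstab ν T t u p hν hT hmax.1 hLH hdec ht0 htT x₀ L V Q hL hV hbd hnear hRe hlate v q
    Mv hv hvax hvbd hvclose
  apply hsing
  have hK₀ : 0 < K₀ := lt_of_lt_of_le one_pos hK₀1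
  have hTt : 0 < T - t := sub_pos.2 htT
  set ρ : ℝ := min (K₀ * L / 4) (Real.sqrt (T - t)) with hρ
  have hρpos : 0 < ρ := lt_min (by positivity) (Real.sqrt_pos.2 hTt)
  have hρsq : ρ ^ 2 ≤ T - t :=
    calc ρ ^ 2 ≤ (Real.sqrt (T - t)) ^ 2 := pow_le_pow_left₀ hρpos.le (min_le_right _ _) 2
      _ = T - t := Real.sq_sqrt hTt.le
  have hρle : ρ ≤ K₀ * L / 4 := min_le_left _ _
  refine ⟨ρ, M, hρpos, fun s hs x hx => hM s ⟨?_, hs.2⟩ x ?_⟩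
  · linarith [hs.1]
  · rw [mem_ball] at hx ⊢
    calc dist x x₀ ≤ dist x xs + dist xs x₀ := dist_triangle _ _ _
      _ < ρ + K₀ * L / 4 := by linarith
      _ ≤ K₀ * L / 4 + K₀ * L / 4 := by linarith
      _ = K₀ * L / 2 := by ring

end CoreExclusionShadowing

end Summit.NavierStokesRegularity.NavierStokesRegularity.Theorems

end
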